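import Literature.MathematicalPhysics.QuantumFieldTheory.QCDOS

/-!
# Line `proper-time-quarantine`, stub 6 (`stub_polymerTransfer`) — landed glue around its conclusion
(crux `Summit.QuantumFields.QCD.Theses.NestedDissectionSea.SeaFactorisationBridge`, item stmt-QuantumFields-13880)

Pure-logic facts about the OUTPUT format of the Kotecký–Preiss transfer (skeleton r12, §6), landed so that the
skeleton can import them instead of restating them (wave-5 stub-6 worker):

* `hasMassGap_anti` — a continuum gap `Δ` of a labelled Schwinger family is a gap `Δ' ≤ Δ`;
* `hasLatticeMassGap_anti` — the same for the uniform lattice gap of a QCD scheme;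
* `hasLatticeMassGap_scheme_irrel` — the lattice gap clause does not see the species renormalisations `(z, shift)`;
* `signedLatticeGap_iff_forall_scheme` — hence the skeleton's `SignedLatticeGap reg m` (stated at `(z, shift) = (0, 0)`)
  is the lattice gap of EVERY scheme `reg.scheme m z shift`;
* `signedLatticeQCD_iff_split` — the conclusion of stub 6, `SignedLatticeQCD reg m`, splits EXACTLY into its continuum
  half `SignedContinuumQCD reg m` and its lattice half `SignedLatticeGap reg m` (common rate `min Δ₁ Δ₂`).

All three skeleton predicates are UNFOLDED verbatim in the statements below (they are `def`s of the skeleton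
`Cruxes/SeaFactorisationBridge/Lines/proper_time_quarantine.lean`, §6), so the skeleton's versions follow by `exact`.
-/

noncomputable section

namespace Summit.QuantumFields.QCD.Cruxes.SeaFactorisationBridge.ProperTimeQuarantine.PolymerGlue

open scoped SchwartzMap Topology
open Filter
open Literature.MathematicalPhysics.AQFT
open Literature.MathematicalPhysics.QuantumFieldTheory Literature.MathematicalPhysics.QuantumLattice

/-- Gap monotonicity for labelled Schwinger families: a gap `Δ` is a gap `Δ' ≤ Δ`. -/
theorem hasMassGap_anti {ι : Type} {S : LabelledSchwingerFamily ι (EuclideanSpace ℝ (Fin 4))} {Δ Δ' : ℝ}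
    (h : S.HasMassGap Δ) (hle : Δ' ≤ Δ) : S.HasMassGap Δ' := by
  intro n n' k k' F G hF hG
  obtain ⟨C, hC⟩ := h n n' k k' F G hF hG
  refine ⟨max C 0, fun t ht H hH => (hC t ht H hH).trans ?_⟩
  have h1 : Real.exp (-Δ * t) ≤ Real.exp (-Δ' * t) := Real.exp_le_exp.2 (by nlinarith)
  calc C * Real.exp (-Δ * t) ≤ max C 0 * Real.exp (-Δ * t) :=
        mul_le_mul_of_nonneg_right (le_max_left _ _) (Real.exp_nonneg _)
    _ ≤ max C 0 * Real.exp (-Δ' * t) := mul_le_mul_of_nonneg_left h1 (le_max_right _ _)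

variable {Nf : ℕ}

/-- Gap monotonicity for the lattice gap of a QCD scheme: a gap `Δ` is a gap `Δ' ≤ Δ`. -/
theorem hasLatticeMassGap_anti {sch : QCDScheme Nf} {Δ Δ' : ℝ}
    (h : sch.HasLatticeMassGap Δ) (hle : Δ' ≤ Δ) : sch.HasLatticeMassGap Δ' := by
  intro R R' A B
  obtain ⟨C, hC⟩ := h R R' A B
  refine ⟨max C 0, ?_⟩
  filter_upwards [hC] with k hk S hS n hn
  refine (hk S hS n hn).trans ?_
  have hx : 0 ≤ sch.a k * n := mul_nonneg (sch.a_pos k).le (Nat.cast_nonneg n)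
  have h1 : Real.exp (-(Δ * (sch.a k * n))) ≤ Real.exp (-(Δ' * (sch.a k * n))) :=
    Real.exp_le_exp.2 (by nlinarith)
  calc C * Real.exp (-(Δ * (sch.a k * n))) ≤ max C 0 * Real.exp (-(Δ * (sch.a k * n))) :=
        mul_le_mul_of_nonneg_right (le_max_left _ _) (Real.exp_nonneg _)
    _ ≤ max C 0 * Real.exp (-(Δ' * (sch.a k * n))) := mul_le_mul_of_nonneg_left h1 (le_max_right _ _)

/-- The lattice gap clause does not see the species renormalisations `(z, shift)` (definitional). -/
theorem hasLatticeMassGap_scheme_irrel (reg : QCDRegularisation Nf) (m : Fin Nf → ℝ)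
    (z shift z' shift' : QCDField Nf → ℕ → ℝ) (Δ : ℝ) :
    (reg.scheme m z shift).HasLatticeMassGap Δ ↔ (reg.scheme m z' shift').HasLatticeMassGap Δ :=
  Iff.rfl

/-- The skeleton's `SignedLatticeGap reg m` (unfolded: a positive lattice gap of `reg.scheme m 0 0`) is a positive
lattice gap of EVERY scheme `reg.scheme m z shift` realising the tuple `m`. -/
theorem signedLatticeGap_iff_forall_scheme (reg : QCDRegularisation Nf) (m : Fin Nf → ℝ) :
    (∃ Δ : ℝ, 0 < Δ ∧ (reg.scheme m 0 0).HasLatticeMassGap Δ) ↔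
      ∀ z shift : QCDField Nf → ℕ → ℝ, ∃ Δ : ℝ, 0 < Δ ∧ (reg.scheme m z shift).HasLatticeMassGap Δ :=
  ⟨fun h _ _ => h, fun h => h 0 0⟩

/-- **The conclusion of stub 6 splits exactly** into its continuum half and its lattice half (the skeleton's
`SignedLatticeQCD reg m ↔ SignedContinuumQCD reg m ∧ SignedLatticeGap reg m`, all three unfolded verbatim; the
common rate is `min Δ₁ Δ₂`). -/
theorem signedLatticeQCD_iff_split : ∀ {Nf : ℕ} (reg : QCDRegularisation Nf) (m : Fin Nf → ℝ),
    (∃ (z shift : QCDField Nf → ℕ → ℝ)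
        (S : LabelledSchwingerFamily (QCDField Nf) (EuclideanSpace ℝ (Fin 4))) (hS : OSAxiomsSchwinger S),
        (∀ n : ℕ, n ≠ 0 → ∀ (σ : Fin n → QCDField Nf) (f : Fin n → 𝓢(EuclideanSpace ℝ (Fin 4), ℝ))
            (F : 𝓢((Fin n → EuclideanSpace ℝ (Fin 4)), ℂ)),
            IsTensorOf F (fun i => ofRealTest (f i)) → IsOffDiagonal F →
              Tendsto (fun k : ℕ => qcdLatticeSchwinger (reg.scheme m z shift) k n σ f) atTop (𝓝 (S n σ F))) ∧
        (OSData.ofAxioms S hS).IsNontrivial QCDField.glue ∧ (OSData.ofAxioms S hS).IsNonGaussian QCDField.glue ∧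
        (∀ f g : Fin Nf, f ≠ g → (OSData.ofAxioms S hS).IsNontrivial (QCDField.pseudoRe f g)) ∧
        ∃ Δ : ℝ, 0 < Δ ∧ S.HasMassGap Δ ∧ (reg.scheme m z shift).HasLatticeMassGap Δ) ↔
    (∃ (z shift : QCDField Nf → ℕ → ℝ)
        (S : LabelledSchwingerFamily (QCDField Nf) (EuclideanSpace ℝ (Fin 4))) (hS : OSAxiomsSchwinger S),
        (∀ n : ℕ, n ≠ 0 → ∀ (σ : Fin n → QCDField Nf) (f : Fin n → 𝓢(EuclideanSpace ℝ (Fin 4), ℝ))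
            (F : 𝓢((Fin n → EuclideanSpace ℝ (Fin 4)), ℂ)),
            IsTensorOf F (fun i => ofRealTest (f i)) → IsOffDiagonal F →
              Tendsto (fun k : ℕ => qcdLatticeSchwinger (reg.scheme m z shift) k n σ f) atTop (𝓝 (S n σ F))) ∧
        (OSData.ofAxioms S hS).IsNontrivial QCDField.glue ∧ (OSData.ofAxioms S hS).IsNonGaussian QCDField.glue ∧
        (∀ f g : Fin Nf, f ≠ g → (OSData.ofAxioms S hS).IsNontrivial (QCDField.pseudoRe f g)) ∧
        ∃ Δ : ℝ, 0 < Δ ∧ S.HasMassGap Δ) ∧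
      (∃ Δ : ℝ, 0 < Δ ∧ (reg.scheme m 0 0).HasLatticeMassGap Δ) := by
  intro Nf reg m
  constructor
  · rintro ⟨z, sh, S, hS, hconv, hNT, hNG, hps, Δ, hΔ, hgap, hlgap⟩
    exact ⟨⟨z, sh, S, hS, hconv, hNT, hNG, hps, Δ, hΔ, hgap⟩, Δ, hΔ,
      (hasLatticeMassGap_scheme_irrel reg m z sh 0 0 Δ).1 hlgap⟩
  · rintro ⟨⟨z, sh, S, hS, hconv, hNT, hNG, hps, Δ₁, hΔ₁, hgap⟩, Δ₂, hΔ₂, hlgap⟩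
    refine ⟨z, sh, S, hS, hconv, hNT, hNG, hps, min Δ₁ Δ₂, lt_min hΔ₁ hΔ₂,
      hasMassGap_anti hgap (min_le_left _ _), ?_⟩
    exact (hasLatticeMassGap_scheme_irrel reg m z sh 0 0 _).2 (hasLatticeMassGap_anti hlgap (min_le_right _ _))

end Summit.QuantumFields.QCD.Cruxes.SeaFactorisationBridge.ProperTimeQuarantine.PolymerGlue

end
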